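import Summits.ResolutionOfSingularities.ResolutionOfSingularities.Theorems.PerronAscent
import HarnessLib

/-!
# PerronLadder — decomp-res node «PerronLadder» (lens-1 g17 KaplanskyLadder → g18 PerronLadder), tree file
11/11 of the node

Content VERBATIM from the decomp-res lens-1 g18 file `HOME/decomp-res-lens-1/g18/PerronLadder.lean` (sha256
8bb02ceefe11b749, 3725 l; it SUPERSEDES
g17 `KaplanskyLadder.lean` fb35e2e5 ⊇ g16 `ToricLadder.lean` 67376591 as landing source; PARTS I–III = the
landed `Theorems/ToricLadderCells`,
`ToricLadderKernels`, `ToricLadderLinks`, `ToricLadderDense`, `ToricLadder` — not repeated).  HOME =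
run/shared/lean/pub/decomp-res.  Critic:
CRITIC-LEDGER rows 131 (g17, 2026-08-30T18:47:14Z) and 138 (g18 CLEARED, landing order 2026-08-30T20:05:14Z); the
lens's WRITER.md (endorsed).
Landed by decomp-res writer g7 as SUPPORT of the Valuative route item 0641 `LuAlphaPTorsor` (helper files; no
Valuative route edit is made by the
decomp-res cell: the support ports Σ₁ `MonoidalStep` / Π₁ `KK05NCVAscent`, the retirement of g16's all-rank
`ToricAscent 3` in favour of the theorem
`toricAscentRk1_three`, and the UNCHANGED located residual `NonKHToricArchLU 3 3 4` / port-free `NonKHArchLU 3 4`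
stay documented tree definitions
for the Valuative tenure / operator to book).

PART V-H (g18 NEW) §24 the rank-one toric ascent on the ladder: `ToricAscentRk1`, **`toricAscentRk1_three`** (the
port-shaped target
`ToricAscent 3` of the toric ladder DECIDED in rank-one form modulo CJS-2020 + Σ₁ + Π₁), the rank-one cell
`ToricDenseLURk1`, the exact cuts at base
bound 3 instantiated with the Perron data (`luRel_four_iff_nonKHToric_three_perron`,
`luRel_four_iff_nonToric_three_perron`), root / host links
(`closes_perron*`, `root_iff_*_perron`).

[WRITER NOTE (decomp-res writer g7): namespaces `…Theses.PerronLadder` ↦ `…Theorems.KaplanskyLadder` (PART IV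
= g17 §14–§16, files
`KaplanskyLadder`, `KaplanskyLadderDefectless`) and ↦ `…Theorems.PerronLadder` (PART V, files `PerronMerge`
§17, `PerronCharts` §18–§19,
`PerronMonomialization` §20, `PerronInitialChartPrelim` + `PerronInitialChart` §21 (400-line limit),
`PerronRepresentations` §22, `PerronAscent`
§23, `PerronLadder` §24; PART IV likewise `KaplanskyHensel` §14 / `KaplanskyLadder` §15), with `open
…Theorems.ToricLadder` (+ `…KaplanskyLadder`) so the lens's unqualified references stay verbatim; `section PartV` and its
section-scoped `open`s re-opened per file; the g16 helper `intermediateField_top_fg` is the landed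
`PfaffLine.intermediateField_top_fg_of_isFractionRing`
(renamed at its use, as in the landed `ToricLadder`); global `set_option` lines dropped; nothing else changed.]

(Sources: CossartPiltant2019; CossartJannsenSaito2020; KnafKuhlmann2005 arXiv:math/0304159 §4 Thm 4.1, Lemmas
4.2–4.4; KnafKuhlmann2009 arXiv:math/0702856 Prop 3.11, Thm 1.5; Kaplansky1942 Lemma 5, Thm 3; Kuhlmann2010 Thm
2.14; Zariski1940 §B; Cutkosky arXiv:1404.7459 §2.1; ZariskiSamuelII.)
-/

noncomputable section

open IsLocalRing Literature.AlgebraicGeometry.Resolution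
open Summit.ResolutionOfSingularities.ResolutionOfSingularities.Theses
open Summit.ResolutionOfSingularities.ResolutionOfSingularities.Theorems
open Summit.ResolutionOfSingularities.ResolutionOfSingularities.Theorems.PfaffLine
open Summit.ResolutionOfSingularities.ResolutionOfSingularities.Theorems.ToricLadder
open Summit.ResolutionOfSingularities.ResolutionOfSingularities.Theorems.KaplanskyLadder

namespace Summit.ResolutionOfSingularities.ResolutionOfSingularities.Theorems.PerronLadder

section PartV

open Finset
open CategoryTheory CategoryTheory.Limits AlgebraicGeometry TopologicalSpace
open Scheme.IdealSheafData
open scoped Classical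

/-! ## 24. PART V-H · The rank-one toric ascent on the ladder: the new cell, the exact cuts at base
bound `3`, and ROOT BY NAME (`closes_perron`) -/

section RankOneCuts

variable {k : Type} [Field k] {K : Type} [Field K] [Algebra k K]

/-- **PORT-SHAPED TARGET, RANK ONE** (tag DECIDED for `e = 3` modulo the named fact CJS-2020 and the two
printed engines Σ₁, Π₁ — `toricAscentRk1_three`; WEAKER than the root — `toricAscentRk1_of_root`):
the g16/g17 toric ascent `ToricAscent e` restricted to valuation rings of RANK ONE (the only ones the
located residuals `NonToricArchLU e n`, `NonKHToricArchLU e c n` quantify over).  Text = `ToricAscent e`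
verbatim with `Nonempty O.valuation.RankOne →` inserted after the ground-field hypothesis. -/
def ToricAscentRk1 (e : ℕ) : Prop :=
  ∀ p : ℕ, p.Prime → ∀ (k K : Type) [Field k] [CharP k p] [Field K] [Algebra k K]
    (O : ValuationSubring K), (∀ c : k, algebraMap k K c ∈ O) → Nonempty O.valuation.RankOne →
    ∀ F₁ : IntermediateField k K, F₁.FG → Algebra.trdeg k F₁ ≤ e →
    RelLocalUniformization k F₁ (O.comap (algebraMap F₁ K)) →
    ∀ (ρ : ℕ) (x : Fin ρ → K), IsValIndepOver O F₁ x →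
    ∀ Z : Finset K, (∀ z ∈ Z, z ∈ O ∧ z ∈ (toricField F₁ x).toSubfield) →
      ∃ (B : Subalgebra k K) (hB : B.toSubring ≤ O.toSubring),
        (B : Set K) ⊆ (toricField F₁ x).toSubfield ∧ (Z : Set K) ⊆ B ∧ B.FG ∧
        (∀ y ∈ (toricField F₁ x).toSubfield, ∃ a ∈ B, ∃ b ∈ B, y = a / b) ∧
        IsRegularLocalRing
          (Localization.AtPrime (Ideal.comap (Subring.inclusion hB) (IsLocalRing.maximalIdeal O)))

/-- The rank-one restriction is implied by the unrestricted port. [folklore] -/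
theorem toricAscentRk1_of_toricAscent {e : ℕ} (h : ToricAscent e) : ToricAscentRk1 e :=
  fun p hp k K _ _ _ _ O hk _ F₁ hF htr hLU ρ x hx Z hZ => h p hp k K O hk F₁ hF htr hLU ρ x hx Z hZ

/-- **K24 · `ToricAscentRk1 3` DECIDED modulo the NAMED FACT `CossartJannsenSaito2020Embedded` (tree) and
the printed engines Σ₁ (`MonoidalStep`) and Π₁ (`KK05NCVAscent`).**  The regular base `B₀` of `F₁`
comes from the relative local uniformization of `(F₁, O ∩ F₁)` (`regularBase_of_relLU`, kernel, g15);
`toricAscent_core` (PART V-G) does the rest: CJS initial chart monomializing the coefficients of the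
representations of `Z` (PART V-E/F), Perron–Zariski merging to a value-independent parameter family
(Lemma M + Σ₁, PART V-A/C), and the KK05 (NC)+(V) ascent Π₁.  Characteristic-free (the `CharP`
hypothesis of the ladder is not used). [folklore] -/
theorem toricAscentRk1_three (hCJS : CossartJannsenSaito2020Embedded.{0}) (hStep : MonoidalStep)
    (hAsc : KK05NCVAscent) : ToricAscentRk1 3 := by
  intro p hp k K _ _ _ _ O hk hr F₁ hF₁fg htr hLU ρ x hx Z hZ
  obtain ⟨hr⟩ := hr
  obtain ⟨B₀, hB₀O, hB₀F, -, hB₀fg, hfrac, hreg⟩ := regularBase_of_relLU O hk F₁ hF₁fg hLU ∅ (by simp)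
  exact toricAscent_core hCJS hStep hAsc O hk F₁ htr B₀ hB₀O hB₀F hB₀fg hfrac hreg x hx Z hZ

/-- K12 in rank one: relative LU ascends a toric–dense presentation of a RANK-ONE valuation, given
rank-one toric ascent for the base bound (proof = `relLU_of_toricDense` verbatim). [folklore] -/
theorem relLU_of_toricDenseRk1 {p : ℕ} (hp : p.Prime) [CharP k p] {e : ℕ} (hT : ToricAscentRk1 e)
    (O : ValuationSubring K) (hr : Nonempty O.valuation.RankOne) (F₁ : IntermediateField k K)
    (hF₁fg : F₁.FG) (htr : Algebra.trdeg k F₁ ≤ e)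
    (hLU : RelLocalUniformization k F₁ (O.comap (algebraMap F₁ K))) {ρ : ℕ} (x : Fin ρ → K)
    (hx : IsValIndepOver O F₁ x)
    (hsep : SeparablyGeneratedOver (toricField F₁ x).toSubfield (⊤ : Subfield K))
    (hdense : IsDenseOver O (toricField F₁ x)) :
    RelLocalUniformization k K O := by
  classical
  intro R hR hfrac hRO
  have hk : ∀ c : k, algebraMap k K c ∈ O := algebraMap_mem_of_le O R hRO
  haveI := hfrac
  have htopfg : (⊤ : IntermediateField k K).FG := PfaffLine.intermediateField_top_fg_of_isFractionRing R hR
  have hkF₀ : (algebraMap k K).fieldRange ≤ (toricField F₁ x).toSubfield := by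
    intro y hy
    obtain ⟨c, rfl⟩ := RingHom.mem_fieldRange.mp hy
    exact (IntermediateField.mem_toSubfield _ _).mpr ((toricField F₁ x).algebraMap_mem c)
  have hB := hT p hp k K O hk hr F₁ hF₁fg htr hLU ρ x hx
  have hdense' : ∀ y w : K, w ≠ 0 →
      ∃ a ∈ (toricField F₁ x).toSubfield, O.valuation (y - a) < O.valuation w := by
    intro y w hw
    obtain ⟨a, ha, hlt⟩ := hdense y w hw
    exact ⟨a, (IntermediateField.mem_toSubfield _ _).mpr ha, hlt⟩
  have hF := stub_stronglySmoothTopOverAbhyankarSubfield k K O htopfg (toricField F₁ x).toSubfield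
    hkF₀ hsep hdense'
  obtain ⟨A, h, hRA, hAfg, -, hreg⟩ :=
    stub_relLU_of_regularBase k K O hk (toricField F₁ x).toSubfield hkF₀ hB hF R hR hRO
  exact ⟨A, h, hRA, hAfg, hreg⟩

/-- CELL, RANK ONE (tag DECIDED for `e = 3` at every rung `n` modulo floor + CJS + Σ₁ + Π₁ —
`toricDenseLURk1_three_perron`; WEAKER than the root): rank-one valuation rings of function fields of
transcendence degree `≤ n` admitting a toric–dense presentation with base bound `e`. -/
def ToricDenseLURk1 (e n : ℕ) : Prop :=
  ∀ p : ℕ, p.Prime → ∀ (k K : Type) [Field k] [CharP k p] [Field K] [Algebra k K],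
    Algebra.trdeg k K ≤ n → ∀ O : ValuationSubring K, Nonempty O.valuation.RankOne →
    ToricDenseBelow k O e → RelLocalUniformization k K O

/-- `toricDenseLURk1_of_toricDenseLU`: Auxiliary step of this node's calculus, VERBATIM from the lens file (see the
module docstring); the statement is its type. [folklore] -/
theorem toricDenseLURk1_of_toricDenseLU {e n : ℕ} (h : ToricDenseLU e n) : ToricDenseLURk1 e n :=
  fun p hp k K _ _ _ _ hd O _ hD => h p hp k K hd O hD

/-- `toricDenseLURk1_of_luRel`: Auxiliary step of this node's calculus, VERBATIM from the lens file (see the module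
docstring); the statement is its type. [folklore] -/
theorem toricDenseLURk1_of_luRel {e n : ℕ} (h : LURel n) : ToricDenseLURk1 e n :=
  fun p hp k K _ _ _ _ hd O _ _ => h p hp k K hd O

/-- **K13 in rank one · THE TORIC LAW ON THE LADDER.**  Rung `e` together with rank-one toric ascent for
base bound `e` decides the rank-one toric–dense cell with base bound `e` at EVERY rung `n`. [folklore] -/
theorem toricDenseLURk1_of_toricAscentRk1 {e : ℕ} (hT : ToricAscentRk1 e) (hL : LURel e) (n : ℕ) :
    ToricDenseLURk1 e n := by
  intro p hp k K _ _ _ _ hn O hr hD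
  obtain ⟨F₁, ρ, x, hF₁fg, htr, hx, hsep, hdense⟩ := hD
  have hL' : RelLocalUniformization k F₁ (O.comap (algebraMap F₁ K)) :=
    hL p hp k F₁ htr (O.comap (algebraMap F₁ K))
  exact relLU_of_toricDenseRk1 hp hT O hr F₁ hF₁fg htr hL' x hx hsep hdense

/-- **K14 in rank one · THE TORIC CUT of the gen-15 residual** needs toric ascent only in rank one (the
residual's valuations ARE of rank one). [folklore] -/
theorem nonSepDenseNonAbh_of_toric_cutRk1 {e n : ℕ} (hT : ToricAscentRk1 e) (hL : LURel e)
    (hN : NonToricArchLU e n) : NonSepDenseNonAbhArchLU n := by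
  intro p hp k K _ _ _ _ hn O hr hzd hA hnd
  by_cases hD : ToricDenseBelow k O e
  · exact toricDenseLURk1_of_toricAscentRk1 hT hL n p hp k K hn O hr hD
  · exact hN p hp k K hn O hr hzd hA hnd hD

/-- **EXACT** in rank one. [folklore] -/
theorem nonSepDenseNonAbh_iff_nonToricRk1 {e : ℕ} (hT : ToricAscentRk1 e) (hL : LURel e) (n : ℕ) :
    NonSepDenseNonAbhArchLU n ↔ NonToricArchLU e n :=
  ⟨nonToricArchLU_of_nonSepDenseNonAbh, nonSepDenseNonAbh_of_toric_cutRk1 hT hL⟩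

/-- The two residual gradings commute in rank one as well. [folklore] -/
theorem nonKH_iff_nonKHToricRk1 {e c : ℕ} (hT : ToricAscentRk1 e) (hLe : LURel e) (n : ℕ) :
    NonKHArchLU c n ↔ NonKHToricArchLU e c n := by
  refine ⟨nonKHToricArchLU_of_nonKH, fun h => ?_⟩
  intro p hp k K _ _ _ _ hn O hr hzd hA hnd hnk
  by_cases hD : ToricDenseBelow k O e
  · exact toricDenseLURk1_of_toricAscentRk1 hT hLe n p hp k K hn O hr hD
  · exact h p hp k K hn O hr hzd hA hnd hD hnk

/-! ### The cuts at base bound `3`, instantiated with the Perron data (floor + CJS + Σ₁ + Π₁) -/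

/-- **NEW CELL, DECIDED-MOD-(CP2019 floor + CJS-2020 named fact + Σ₁ + Π₁)**: at EVERY rung `n`, every
RANK-ONE valuation of a function field of transcendence degree `≤ n` in characteristic `p` (any ground
field) admitting a toric–dense presentation over a finitely generated subfield of transcendence degree
`≤ 3` admits relative local uniformization. [folklore] -/
theorem toricDenseLURk1_three_perron (hCP : CossartPiltant2019LU3.{0})
    (hCJS : CossartJannsenSaito2020Embedded.{0}) (hStep : MonoidalStep) (hAsc : KK05NCVAscent)
    (n : ℕ) : ToricDenseLURk1 3 n :=
  toricDenseLURk1_of_toricAscentRk1 (toricAscentRk1_three hCJS hStep hAsc) (luRel_three_of_cp hCP) n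

/-- **THE g16 WINDOW-(ii) CUT, DECIDED-MOD-PORT**: `NonToricArchLU e 4 ↔ NonToricArchLU 3 4` for every
base bound `e ≤ 3` (in particular `NonToricArchLU 2 4 ↔ NonToricArchLU 3 4`, the g16/g17 statement
`nonToricArchLU_two_four_iff_three` with its hypothesis `ToricAscent 3` DISCHARGED in rank one). [folklore] -/
theorem nonToricArchLU_four_iff_three_perron (hCP : CossartPiltant2019LU3.{0})
    (hCJS : CossartJannsenSaito2020Embedded.{0}) (hStep : MonoidalStep) (hAsc : KK05NCVAscent)
    {e : ℕ} (he : e ≤ 3) : NonToricArchLU e 4 ↔ NonToricArchLU 3 4 :=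
  ⟨nonToricArchLU_mono he, fun h => nonToricArchLU_of_nonSepDenseNonAbh
    (nonSepDenseNonAbh_of_toric_cutRk1 (toricAscentRk1_three hCJS hStep hAsc) (luRel_three_of_cp hCP) h)⟩

/-- `nonToricArchLU_two_four_iff_three_perron`: Auxiliary step of this node's calculus, VERBATIM from the lens file
(see the module docstring); the statement is its type. [folklore] -/
theorem nonToricArchLU_two_four_iff_three_perron (hCP : CossartPiltant2019LU3.{0})
    (hCJS : CossartJannsenSaito2020Embedded.{0}) (hStep : MonoidalStep) (hAsc : KK05NCVAscent) :
    NonToricArchLU 2 4 ↔ NonToricArchLU 3 4 :=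
  nonToricArchLU_four_iff_three_perron hCP hCJS hStep hAsc (by omega)

/-- **THE LOCATED RESIDUAL**: rung 4 is exactly the TRUE non-toric residual `NonToricArchLU 3 4`. [folklore] -/
theorem luRel_four_iff_nonToric_three_perron (hCP : CossartPiltant2019LU3.{0})
    (hCJS : CossartJannsenSaito2020Embedded.{0}) (hStep : MonoidalStep) (hAsc : KK05NCVAscent) :
    LURel 4 ↔ NonToricArchLU 3 4 :=
  (luRel_four_iff_nonAbh_four hCP).trans
    (nonSepDenseNonAbh_iff_nonToricRk1 (toricAscentRk1_three hCJS hStep hAsc) (luRel_three_of_cp hCP) 4)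

/-- … and, off the Kaplansky–Hensel locus (gen 17, port-free cut), exactly `NonKHToricArchLU 3 3 4`. [folklore] -/
theorem luRel_four_iff_nonKHToric_three_perron (hCP : CossartPiltant2019LU3.{0})
    (hCJS : CossartJannsenSaito2020Embedded.{0}) (hStep : MonoidalStep) (hAsc : KK05NCVAscent) :
    LURel 4 ↔ NonKHToricArchLU 3 3 4 :=
  (luRel_four_iff_nonToric_three_perron hCP hCJS hStep hAsc).trans (nonToric_two_four_iff_nonKH hCP 3)

/-- `nonKH_three_four_iff_nonKHToric_perron`: Auxiliary step of this node's calculus, VERBATIM from the lens file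
(see the module docstring); the statement is its type. [folklore] -/
theorem nonKH_three_four_iff_nonKHToric_perron (hCP : CossartPiltant2019LU3.{0})
    (hCJS : CossartJannsenSaito2020Embedded.{0}) (hStep : MonoidalStep) (hAsc : KK05NCVAscent) :
    NonKHArchLU 3 4 ↔ NonKHToricArchLU 3 3 4 :=
  nonKH_iff_nonKHToricRk1 (toricAscentRk1_three hCJS hStep hAsc) (luRel_three_of_cp hCP) 4

/-- **`closes_perron` — ROOT BY NAME (deciding theorem of this node).**  Cossart–Piltant floor (print) +
CJS-2020 embedded resolution of surfaces in excellent threefolds (NAMED FACT, tree) + the monoidal step Σ₁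
(print) + the KK05 (NC)+(V) ascent Π₁ (print) + the non-toric, non-Kaplansky–Hensel residuals with base
bounds `(3, 3)` in transcendence degree `≥ 4` + the route's patching crux 0642 ⇒ `ResolutionOfSingularities`. [folklore] -/
theorem closes_perron (hCP : CossartPiltant2019LU3.{0}) (hCJS : CossartJannsenSaito2020Embedded.{0})
    (hStep : MonoidalStep) (hAsc : KK05NCVAscent) (hN : ∀ d, 4 ≤ d → NonKHToricArchLU 3 3 d)
    (h₃ : Valuative.PatchingRel) : _root_.ResolutionOfSingularities :=
  closes_kaplansky hCP (fun d hd =>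
    (nonKH_iff_nonKHToricRk1 (toricAscentRk1_three hCJS hStep hAsc) (luRel_three_of_cp hCP) d).2
      (hN d hd)) h₃

/-- The same through the route's own deciding theorem `Valuative.closes`. [folklore] -/
theorem closes_perron' (hCP : CossartPiltant2019LU3.{0}) (hCJS : CossartJannsenSaito2020Embedded.{0})
    (hStep : MonoidalStep) (hAsc : KK05NCVAscent) (hN : ∀ d, 4 ≤ d → NonKHToricArchLU 3 3 d)
    (h₄ : Valuative.TorsorToLurel) (h₃ : Valuative.PatchingRel) : _root_.ResolutionOfSingularities :=
  Valuative.closes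
    (luAlphaPTorsor_of_nonSepDense hCP (fun d hd => (nonSepDenseArchLU_iff_nonAbh d).2
      (nonSepDenseNonAbh_of_toric_cutRk1 (toricAscentRk1_three hCJS hStep hAsc) (luRel_three_of_cp hCP)
        (nonToric_of_kh_cut (luRel_three_of_cp hCP) (hN d hd))))) h₄ h₃

/-- The toric-only version (no Kaplansky–Hensel cut): residuals `NonToricArchLU 3 d`, `d ≥ 4`. [folklore] -/
theorem closes_perron_toric (hCP : CossartPiltant2019LU3.{0})
    (hCJS : CossartJannsenSaito2020Embedded.{0}) (hStep : MonoidalStep) (hAsc : KK05NCVAscent)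
    (hN : ∀ d, 4 ≤ d → NonToricArchLU 3 d) (h₃ : Valuative.PatchingRel) :
    _root_.ResolutionOfSingularities :=
  closes_final hCP (fun d hd => nonSepDenseNonAbh_of_toric_cutRk1 (toricAscentRk1_three hCJS hStep hAsc)
    (luRel_three_of_cp hCP) (hN d hd)) h₃

/-- **WEAKER (kernel): the rank-one port-shaped target and the rank-one cell are consequences of the ROOT
and of the host's cone.** [folklore] -/
theorem toricAscentRk1_of_root (hS : _root_.ResolutionOfSingularities) (e : ℕ) : ToricAscentRk1 e :=
  toricAscentRk1_of_toricAscent (toricAscent_of_root hS e)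

/-- `toricAscentRk1_of_hostCone`: Auxiliary step of this node's calculus, VERBATIM from the lens file (see the
module docstring); the statement is its type. [folklore] -/
theorem toricAscentRk1_of_hostCone (h₂ : Valuative.LuAlphaPTorsor) (h₄ : Valuative.TorsorToLurel)
    (e : ℕ) : ToricAscentRk1 e :=
  toricAscentRk1_of_toricAscent (toricAscent_of_hostCone h₂ h₄ e)

/-- `toricDenseLURk1_of_root`: Auxiliary step of this node's calculus, VERBATIM from the lens file (see the module
docstring); the statement is its type. [folklore] -/
theorem toricDenseLURk1_of_root (hS : _root_.ResolutionOfSingularities) (e n : ℕ) : ToricDenseLURk1 e n :=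
  toricDenseLURk1_of_luRel (luRel_of_root hS n)

/-- `toricDenseLURk1_of_hostCone`: Auxiliary step of this node's calculus, VERBATIM from the lens file (see the
module docstring); the statement is its type. [folklore] -/
theorem toricDenseLURk1_of_hostCone (h₂ : Valuative.LuAlphaPTorsor) (h₄ : Valuative.TorsorToLurel)
    (e n : ℕ) : ToricDenseLURk1 e n :=
  toricDenseLURk1_of_luRel (luRel_of_hostCone h₂ h₄ n)

/-- Summary (root-level): `ResolutionOfSingularities` is equivalent, modulo the Cossart–Piltant floor, the
CJS named fact, the two printed engines and the route's patching crux, to the residuals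
`NonKHToricArchLU 3 3 d`, `d ≥ 4` (equivalently `NonToricArchLU 3 d`, `d ≥ 4`). [folklore] -/
theorem root_iff_nonKHToric_perron (hCP : CossartPiltant2019LU3.{0})
    (hCJS : CossartJannsenSaito2020Embedded.{0}) (hStep : MonoidalStep) (hAsc : KK05NCVAscent)
    (h₃ : Valuative.PatchingRel) :
    _root_.ResolutionOfSingularities ↔ ∀ d, 4 ≤ d → NonKHToricArchLU 3 3 d :=
  ⟨fun hS d _ => nonKHToricArchLU_of_root hS 3 3 d, fun hN => closes_perron hCP hCJS hStep hAsc hN h₃⟩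

/-- `root_iff_nonToric_perron`: Auxiliary step of this node's calculus, VERBATIM from the lens file (see the module
docstring); the statement is its type. [folklore] -/
theorem root_iff_nonToric_perron (hCP : CossartPiltant2019LU3.{0})
    (hCJS : CossartJannsenSaito2020Embedded.{0}) (hStep : MonoidalStep) (hAsc : KK05NCVAscent)
    (h₃ : Valuative.PatchingRel) :
    _root_.ResolutionOfSingularities ↔ ∀ d, 4 ≤ d → NonToricArchLU 3 d :=
  ⟨fun hS d _ => nonToricArchLU_of_root hS 3 d, fun hN => closes_perron_toric hCP hCJS hStep hAsc hN h₃⟩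

/-- Summary (residual-level): modulo floor + CJS + Σ₁ + Π₁ the gen-15 residual family IS the true
non-toric residual family: `(∀ d ≥ 4, NonSepDenseNonAbhArchLU d) ↔ (∀ d ≥ 4, NonToricArchLU 3 d)`. [folklore] -/
theorem nonSepDenseNonAbh_iff_nonToric_three_all (hCP : CossartPiltant2019LU3.{0})
    (hCJS : CossartJannsenSaito2020Embedded.{0}) (hStep : MonoidalStep) (hAsc : KK05NCVAscent) :
    (∀ d, 4 ≤ d → NonSepDenseNonAbhArchLU d) ↔ ∀ d, 4 ≤ d → NonToricArchLU 3 d :=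
  ⟨fun hA d hd => nonToricArchLU_of_nonSepDenseNonAbh (hA d hd),
    fun hN d hd => nonSepDenseNonAbh_of_toric_cutRk1 (toricAscentRk1_three hCJS hStep hAsc)
      (luRel_three_of_cp hCP) (hN d hd)⟩

end RankOneCuts

end PartV

end Summit.ResolutionOfSingularities.ResolutionOfSingularities.Theorems.PerronLadder
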